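import Literature.MathematicalPhysics.QuantumLattice.GrassmannWeightedEffectiveActionBiGradedDB
import Literature.MathematicalPhysics.QuantumLattice.GrassmannWeightedEffectiveActionRepresentation
import Literature.MathematicalPhysics.QuantumLattice.GrassmannEffectiveActionBiGradedMap
import HarnessLib

/-!
# The decay-weighted bi-graded single-scale step read in another representation of the fields (determinant-bounded covariance)

Topic `MathematicalPhysics/QuantumLattice`; the WEIGHTED form of `GrassmannEffectiveActionBiGradedMap`
(`kernelNorm_kernel_map_effAction_le_biquartic_of_gramBounded`) and the bi-graded, determinant-bounded form of
`GrassmannWeightedEffectiveActionRepresentation` (`sum_wt_norm_kernel_map_effAction_le`), Benfatto–Giuliani–Mastropietro 2006, §2.5–2.8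
with the moment bookkeeping of §3 (3.2)–(3.8).  The interaction of the physical fields is `V = map f Ṽ` for an even polynomial `Ṽ` of
auxiliary fields (labels `Γ'` at positions `π' : Γ' → Λ`) with kernels of degrees `≤ 4` only, the Gaussian integration runs on the auxiliary
fields with the pulled-back covariance `C' = Mᵀ C M` — replica-stably Gram-BOUNDED with constant `κ` (`IsGramBoundedR`; no Gram form needed:
the scale-`0` chronological propagator of a lattice fermion model is determinant-bounded, de Siqueira Pedra–Salmhofer 2008) — and the output is
read through an analysis map `g` (labels `Γ''` at positions `π'' : Γ'' → Λ`).  For a tree weight `wt` on `Finset Λ` (e.g. `1 + diam`): if the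
kernels of `Ṽ` have `wt`-weighted pinned `L¹` norms `N(m')` (`N(m') = 0` for `m' > 2`), the entries of `C'` have row and column sums `≤ α`
against the pair weights `wt{π' X, π' Y}`, and the entries of `E M` (`E = toMatrix' g`) have row / column sums `≤ cr / cc` against
`wt{π'' X'', π' X'}`, then with `θ = eα‖Ṽ‖_{h,wt}/κ² < 1` the normalised partition function is a unit and, in every output degree `2p`,
`p ≥ 2`, one output leg pinned and the output POSITIONS weighted,

`Σ_{X'' : X''_q = w''} wt(π'' X'') ‖kernel (map g (effAction C V)) (2p) X''‖ ≤ cr · cc^{2p-1} · ρ^{-2p} · e f₂ · θ₂^{p-2} / (1 - θ)^p`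

(**`sum_wt_norm_kernel_map_effAction_le_biquartic_of_gramBounded`**), `f₂ = (e²(κ+ρ))⁴N(2)`, `θ₂ = eαf₂/κ²`: the weighted bi-graded engine
(`sum_wt_norm_kernel_effAction_le_biquartic_of_gramBounded`, weight pulled back to `Γ'` along `π'`) followed by the weighted Young inequality
(`sum_filter_wt_norm_kernel_map_le`).  Used by the scale-`0` first-moment bound (E4)₀ of the K3 engine of the cell gate-hubbard-kl: the first
space-time moment of the sectorised quartic kernel is of order ONE in the quartic coupling whatever the weighted size of the counterterm.

Everything is proved; no definitions, no named facts.

## Sources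

G. Benfatto, A. Giuliani, V. Mastropietro, Ann. Henri Poincaré 7 (2006) 809–898, §2.7 (2.66)–(2.73), §2.8 (2.76)–(2.83), §3 (3.2)–(3.8)
[`BenfattoGiulianiMastropietro2006`]; W. de Siqueira Pedra, M. Salmhofer, Comm. Math. Phys. 282 (2008) 797–818, Thm 1.3, Thm 2.4
[`PedraSalmhofer2008`]; M. Salmhofer, Commun. Math. Phys. 194 (1998) 249–295, §4.1 [`Salmhofer1998`].
-/

noncomputable section

namespace Literature.MathematicalPhysics.QuantumLattice

open GrassmannAlgebra Finset Literature.Probability.LatticeModels Literature.Probability.LatticeModels.BattleFederbush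
open scoped InnerProductSpace

universe u

variable {𝕜 : Type*} [RCLike 𝕜] {Γ Γ' Γ'' : Type u} {Λ : Type*} [Fintype Γ] [DecidableEq Γ] [Fintype Γ'] [DecidableEq Γ']
  [Fintype Γ''] [DecidableEq Γ''] [DecidableEq Λ] {wt : Finset Λ → ℝ}

/-- **Weighted Young for `map f`, any positive degree** (`sum_filter_wt_norm_kernel_map_le` with the degree written as `m` rather than
`m + 1`): `Σ_{X' : X'_p = w'} wt(π' X') ‖kernel (map f F) m X'‖ ≤ cr · cc^{m-1} · N`. [cite: BenfattoGiulianiMastropietro2006, (2.71a)] -/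
theorem sum_filter_wt_norm_kernel_map_le_of_pos (hwt : IsTreeWeight wt) (π : Γ → Λ) (π' : Γ' → Λ) (f : (Γ → 𝕜) →ₗ[𝕜] (Γ' → 𝕜))
    {cr cc : ℝ} (hcc0 : 0 ≤ cc)
    (hrow : ∀ y', ∑ x, ‖LinearMap.toMatrix' f y' x‖ * wt {π' y', π x} ≤ cr)
    (hcol : ∀ x, ∑ y', ‖LinearMap.toMatrix' f y' x‖ * wt {π' y', π x} ≤ cc)
    (F : GrassmannAlgebra 𝕜 Γ) {m : ℕ} (hm : 0 < m) {N : ℝ} (hN0 : 0 ≤ N)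
    (hN : ∀ (q : Fin m) (x : Γ), ∑ X ∈ univ.filter (fun X : Fin m → Γ => X q = x),
      ‖kernel 𝕜 F m X‖ * wt ((univ.image X).image π) ≤ N)
    (p : Fin m) (w' : Γ') :
    ∑ X' ∈ univ.filter (fun X' : Fin m → Γ' => X' p = w'), wt ((univ.image X').image π') *
        ‖kernel 𝕜 (ExteriorAlgebra.map f F) m X'‖ ≤ cr * cc ^ (m - 1) * N := by
  obtain ⟨n, rfl⟩ : ∃ n, m = n + 1 := ⟨m - 1, by omega⟩
  rw [Nat.add_sub_cancel]
  exact sum_filter_wt_norm_kernel_map_le hwt π π' f hcc0 hrow hcol F n hN0 hN p w'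

/-- **The decay-weighted bi-graded single-scale step read in another representation of the fields, determinant-bounded covariance**
(BGM 2006, (2.77) with (2.71a), (2.80)–(2.82), (2.13)–(2.14) and §3).  Let `V = map f Ṽ` with `Ṽ` EVEN without constant part on the auxiliary
labels `Γ'` (positions `π'`), kernels of degrees `≤ 4` (`wt`-weighted pinned sums `≤ N(m')`, `N(m') = 0` for `m' > 2`), `C' = Mᵀ C M`
replica-stably Gram-bounded with constant `κ`, row and column sums of `‖C'(X,Y)‖ wt{π' X, π' Y}` at most `α`, `ρ > 0`,
`θ = eα‖Ṽ‖_{h,wt}/κ² < 1`; and let `E M` (`E = toMatrix' g`, output positions `π''`) have row sums of `‖(E M)(X'',X')‖ wt{π'' X'', π' X'}` at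
most `cr` and column sums at most `cc`.  THEN `∫ dμ_C e^{-V}` is a unit and for `p ≥ 2`, one output leg pinned,
`Σ_{X'' : X''_q = w''} wt(π'' X'') ‖kernel (map g (effAction C V)) (2p) X''‖ ≤ cr · cc^{2p-1} · (ρ^{-2p} · e f₂ · θ₂^{p-2} / (1 - θ)^p)`.
[cite: BenfattoGiulianiMastropietro2006, (2.77) with (2.71a), (2.80)-(2.82), (2.13)-(2.14) and §3 (3.2)-(3.8)] -/
theorem sum_wt_norm_kernel_map_effAction_le_biquartic_of_gramBounded (hwt : IsTreeWeight wt) (π' : Γ' → Λ) (π'' : Γ'' → Λ)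
    (C : Matrix Γ Γ 𝕜) (f : (Γ' → 𝕜) →ₗ[𝕜] (Γ → 𝕜)) (g : (Γ → 𝕜) →ₗ[𝕜] (Γ'' → 𝕜))
    (Vt : GrassmannAlgebra 𝕜 Γ') (hVt : Vt ∈ evenPart 𝕜 Γ') (hVt0 : constPart 𝕜 Vt = 0) (N : ℕ → ℝ) (hN0 : ∀ m', 0 ≤ N m')
    (hN : ∀ m' (j : Fin (2 * m')) (w : Γ'), ∑ Y ∈ univ.filter (fun Y : Fin (2 * m') → Γ' => Y j = w),
      ‖kernel 𝕜 Vt (2 * m') Y‖ * wt ((univ.image Y).image π') ≤ N m')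
    (hN2 : ∀ m', 2 < m' → N m' = 0)
    {κ : ℝ} (hκ : 0 < κ) (hGB : IsGramBoundedR ((LinearMap.toMatrix' f).transpose * C * LinearMap.toMatrix' f) κ)
    {α : ℝ} (hα : 0 < α)
    (hrow : ∀ X, ∑ Y, ‖((LinearMap.toMatrix' f).transpose * C * LinearMap.toMatrix' f) X Y‖ * wt {π' X, π' Y} ≤ α)
    (hcol : ∀ Y, ∑ X, ‖((LinearMap.toMatrix' f).transpose * C * LinearMap.toMatrix' f) X Y‖ * wt {π' X, π' Y} ≤ α)
    {ρ : ℝ} (hρ : 0 < ρ) (hθ : Real.exp 1 * α * normV Γ' κ ρ N / κ ^ 2 < 1)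
    {cr cc : ℝ} (hcc0 : 0 ≤ cc)
    (hrow' : ∀ X'', ∑ X', ‖(LinearMap.toMatrix' g * LinearMap.toMatrix' f) X'' X'‖ * wt {π'' X'', π' X'} ≤ cr)
    (hcol' : ∀ X', ∑ X'', ‖(LinearMap.toMatrix' g * LinearMap.toMatrix' f) X'' X'‖ * wt {π'' X'', π' X'} ≤ cc)
    {p : ℕ} (hp : 2 ≤ p) (q : Fin (2 * p)) (w'' : Γ'') :
    IsUnit (effPartitionFn 𝕜 C (ExteriorAlgebra.map f Vt)) ∧
      ∑ X'' ∈ univ.filter (fun X'' : Fin (2 * p) → Γ'' => X'' q = w''), wt ((univ.image X'').image π'') *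
          ‖kernel 𝕜 (ExteriorAlgebra.map g (effAction 𝕜 C (ExteriorAlgebra.map f Vt))) (2 * p) X''‖ ≤
        cr * cc ^ (2 * p - 1) *
          (ρ⁻¹ ^ (2 * p) * (Real.exp 1 * ((Real.exp 2 * (κ + ρ)) ^ (2 * 2) * N 2)) *
            (Real.exp 1 * α * ((Real.exp 2 * (κ + ρ)) ^ (2 * 2) * N 2) / κ ^ 2) ^ (p - 2) /
              (1 - Real.exp 1 * α * normV Γ' κ ρ N / κ ^ 2) ^ p) := by
  set C' : Matrix Γ' Γ' 𝕜 := (LinearMap.toMatrix' f).transpose * C * LinearMap.toMatrix' f with hC'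
  -- the weight pulled back to the auxiliary labels
  have hwt' : IsTreeWeight (fun S : Finset Γ' => wt (S.image π')) := hwt.comap π'
  have hpair : ∀ X Y : Γ', (fun S : Finset Γ' => wt (S.image π')) {X, Y} = wt {π' X, π' Y} := fun X Y => by
    simp only [image_insert, image_singleton]
  -- the weighted bi-graded single-scale step in the auxiliary representation
  obtain ⟨hunit, hbd⟩ := sum_wt_norm_kernel_effAction_le_biquartic_of_gramBounded C' hwt' hκ hGB Vt hVt hVt0 N hN0 hN hN2 hα
    (fun X => by simp only [hpair]; exact hrow X) (fun Y => by simp only [hpair]; exact hcol Y) hρ hθ hp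
  refine ⟨by rwa [effPartitionFn_map], ?_⟩
  have h2 : 0 ≤ N 2 := hN0 2
  have hB0 : 0 ≤ ρ⁻¹ ^ (2 * p) * (Real.exp 1 * ((Real.exp 2 * (κ + ρ)) ^ (2 * 2) * N 2)) *
      (Real.exp 1 * α * ((Real.exp 2 * (κ + ρ)) ^ (2 * 2) * N 2) / κ ^ 2) ^ (p - 2) /
        (1 - Real.exp 1 * α * normV Γ' κ ρ N / κ ^ 2) ^ p :=
    div_nonneg (by positivity) (pow_nonneg (sub_nonneg.2 hθ.le) _)
  -- every pinned weighted row sum of the auxiliary step obeys the same bound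
  have hbd' : ∀ (q' : Fin (2 * p)) (x : Γ'), ∑ X ∈ univ.filter (fun X : Fin (2 * p) → Γ' => X q' = x),
      ‖kernel 𝕜 (effAction 𝕜 C' Vt) (2 * p) X‖ * wt ((univ.image X).image π') ≤
        ρ⁻¹ ^ (2 * p) * (Real.exp 1 * ((Real.exp 2 * (κ + ρ)) ^ (2 * 2) * N 2)) *
          (Real.exp 1 * α * ((Real.exp 2 * (κ + ρ)) ^ (2 * 2) * N 2) / κ ^ 2) ^ (p - 2) /
            (1 - Real.exp 1 * α * normV Γ' κ ρ N / κ ^ 2) ^ p := by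
    intro q' x
    exact (le_of_eq (sum_congr rfl fun X _ => mul_comm _ _)).trans (hbd q' x)
  -- the output read through `g`: kernels of `map (g ∘ f) (effAction C' Ṽ)`, weighted Young
  rw [effAction_map, map_map_eq_map_comp]
  exact sum_filter_wt_norm_kernel_map_le_of_pos hwt π' π'' (g ∘ₗ f) hcc0
    (by intro X''; rw [LinearMap.toMatrix'_comp]; exact hrow' X'')
    (by intro X'; simp only [LinearMap.toMatrix'_comp]; exact hcol' X') (effAction 𝕜 C' Vt) (by omega) hB0 hbd' q w''

end Literature.MathematicalPhysics.QuantumLattice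

end
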